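import Summits.Ventures.YMGap.FlowData.RectTubeCharacterLine
import Summits.Ventures.YMGap.Census.TwistCensusObjects
import Summits.Ventures.LatticeQCDFlow.Scoring.SU2HandleIdentity
import Summits.Ventures.LatticeQCDFlow.Scoring.SU2CharacterExpansion
import HarnessLib

/-!
# Venture YMGap, track Y3 FLOW-DATA — the HAAR value of a one-site plaquette: on the one-site torus every plaquette is a commutator
# `U V U⁻¹ V⁻¹` and `∫ Re tr(U V U⁻¹ V⁻¹) d(Haar ⊗ Haar) = ½` for `SU(2)` (so `⟨½Tr U_p⟩_Haar = ¼`) (theorems only)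

HONEST FRAMING: venture file of the cell `pub-ymgap` (QuantumFields programme), track Y3 (FLOW-DATA); the Haar constant behind the
strong-coupling law of the magnetic-flux rows on ONE-SITE tori (`RectTubeMagneticTwistOneSite.lean`: `E_mag = β·h_S + O(β²)`; here
`h_{p} = ½` per commutator plaquette, i.e. `E_mag = (β/2)·#S + O(β²)`; FLOW-PLAN R9's «⟨½Tr[U,V]⟩ = ¼» for the one-site `P_s` at
`β → 0`).  Pure group integration (the handle identity `LatticeQCDFlow.Scoring.integral_su2Character_handle` and the orthonormality of
`χ₁`); finite objects; no number of the table, nothing about `L → ∞`, the continuum or a mass gap.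

* `su2_integral_re_trace_commutator` — `∫∫ Re tr(U V U⁻¹ V⁻¹) dU dV = ½` over `SU(2) × SU(2)`;
* `rectPlaquetteHolonomy_of_single_eq_zero` — if `eᵢ = 0 = eⱼ` in `Π ℤ/(Ls ·)` (sides `Ls i = Ls j = 1`) the plaquette holonomy is the
  commutator `a_{x,i} a_{x,j} a_{x,i}⁻¹ a_{x,j}⁻¹`;
* **`su2_integral_re_trace_rectPlaquetteHolonomy_oneSite`** — for such a plaquette with `i ≠ j`:
  `∫ Re tr ρ₂(U_{x,ij}(a)) d(rectSliceMeasure) = ½`.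

References: I. Montvay, G. Münster (1994) §3.2.6 [cite: MontvayMunster1994, §3.2.6].
-/

noncomputable section

open scoped BigOperators ENNReal
open MeasureTheory Filter Function Polynomial.Chebyshev
open Literature.MathematicalPhysics.QuantumFieldTheory Literature.Analysis.OperatorTheory
open Literature.MathematicalPhysics.QuantumLattice (RectTorusSite fundamentalRep continuous_fundamentalRep)
open Summit.Ventures.LatticeQCDFlow.Exactness Summit.Ventures.LatticeQCDFlow.Scoring
open Summit.Ventures.YMGap.Census (RectPlaquette rectPlaquetteHolonomy)

namespace Summit.Ventures.YMGap.FlowData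

/-- **`∫∫ Re tr(U V U⁻¹ V⁻¹) dU dV = ½`** over `SU(2) × SU(2)` (handle identity with `n = 1`, then `∫ χ₁² = 1`). [folklore] -/
theorem su2_integral_re_trace_commutator :
    ∫ g, ∫ h, ((fundamentalRep (Fin 2) (g * h * g⁻¹ * h⁻¹)).trace).re
        ∂haarProbability (Matrix.specialUnitaryGroup (Fin 2) ℂ) ∂haarProbability (Matrix.specialUnitaryGroup (Fin 2) ℂ) = 1 / 2 := by
  have hU1 : ∀ x : ℝ, (U ℝ 1).eval x = 2 * x := fun x => by simp [U_one]
  have hinner : ∀ g : Matrix.specialUnitaryGroup (Fin 2) ℂ,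
      ∫ h, ((fundamentalRep (Fin 2) (g * h * g⁻¹ * h⁻¹)).trace).re ∂haarProbability (Matrix.specialUnitaryGroup (Fin 2) ℂ) =
        (1 / 2) * ((U ℝ 1).eval (su2a0 g) * (U ℝ 1).eval (su2a0 g)) := by
    intro g
    have h := integral_su2Character_handle g g⁻¹ 1
    simp only [Nat.cast_one] at h
    have hre : ∀ h' : Matrix.specialUnitaryGroup (Fin 2) ℂ, ((fundamentalRep (Fin 2) (g * h' * g⁻¹ * h'⁻¹)).trace).re =
        (U ℝ 1).eval (su2a0 (g * h' * g⁻¹ * h'⁻¹)) := fun h' => by rw [fundamentalRep_trace_re, hU1]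
    simp_rw [hre]
    rw [h, su2a0_inv]
    ring
  simp_rw [hinner]
  have horth := integral_su2Character_mul_su2Character 1 1
  simp only [Nat.cast_one] at horth
  rw [integral_const_mul, horth]
  norm_num

variable {k : ℕ} {Ls : Fin k → ℕ}

/-- On sides of length one (`Pi.single i 1 = 0 = Pi.single j 1` in `Π ℤ/(Ls ·)`) the plaquette holonomy is the commutator
`a_{x,i} a_{x,j} a_{x,i}⁻¹ a_{x,j}⁻¹`. [folklore] -/
theorem rectPlaquetteHolonomy_of_single_eq_zero {G : Type*} [Group G] (a : RectSlice Ls G) (x : RectTorusSite Ls) {i j : Fin k}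
    (hi : (Pi.single i 1 : RectTorusSite Ls) = 0) (hj : (Pi.single j 1 : RectTorusSite Ls) = 0) :
    rectPlaquetteHolonomy a x i j = a (x, i) * a (x, j) * (a (x, i))⁻¹ * (a (x, j))⁻¹ := by
  unfold rectPlaquetteHolonomy
  rw [hi, hj, add_zero]

variable [∀ i, NeZero (Ls i)]

/-- **The Haar value of a one-site plaquette**: for a plaquette `(x, i<j)` whose two directions have sides of length one,
`∫ Re tr ρ₂(U_{x,ij}(a)) d(rectSliceMeasure) = ½` (the other links integrate out). [cite: MontvayMunster1994, §3.2.6] -/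
theorem su2_integral_re_trace_rectPlaquetteHolonomy_oneSite (x : RectTorusSite Ls) {i j : Fin k} (hij : i ≠ j)
    (hi : (Pi.single i 1 : RectTorusSite Ls) = 0) (hj : (Pi.single j 1 : RectTorusSite Ls) = 0) :
    ∫ a, ((fundamentalRep (Fin 2) (rectPlaquetteHolonomy a x i j)).trace).re
        ∂(rectSliceMeasure (Matrix.specialUnitaryGroup (Fin 2) ℂ) Ls) = 1 / 2 := by
  classical
  haveI : SecondCountableTopology (Matrix.specialUnitaryGroup (Fin 2) ℂ) :=
    Literature.MathematicalPhysics.QuantumLattice.secondCountableTopology_su2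
  -- the two links of the plaquette as an injective family `ℓ : Fin 2 → links`
  set ℓ : Fin 2 → RectTorusSite Ls × Fin k := ![(x, i), (x, j)] with hℓ
  have hℓinj : Injective ℓ := by
    intro s t hst
    fin_cases s <;> fin_cases t
    · rfl
    · exact absurd (congrArg Prod.snd hst) (by simpa [hℓ] using hij)
    · exact absurd (congrArg Prod.snd hst) (by simpa [hℓ] using hij.symm)
    · rfl
  set s : Set (RectTorusSite Ls × Fin k) := Set.range ℓ with hs
  set e : Fin 2 ⊕ ↥sᶜ ≃ RectTorusSite Ls × Fin k :=
    (Equiv.sumCongr (Equiv.ofInjective ℓ hℓinj) (Equiv.refl _)).trans (Equiv.Set.sumCompl s) with he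
  have he1 : ∀ t : Fin 2, e (Sum.inl t) = ℓ t := fun t => by simp [he, Equiv.Set.sumCompl_apply_inl]
  -- the integrand as a function of the window `Fin 2 → SU(2)`
  set f : (Fin 2 → Matrix.specialUnitaryGroup (Fin 2) ℂ) → ℝ :=
    fun y => ((fundamentalRep (Fin 2) (y 0 * y 1 * (y 0)⁻¹ * (y 1)⁻¹)).trace).re with hf
  have h1 : (fun a : RectSlice Ls (Matrix.specialUnitaryGroup (Fin 2) ℂ) =>
      ((fundamentalRep (Fin 2) (rectPlaquetteHolonomy a x i j)).trace).re) =
      fun a => f (fun t => a (e (Sum.inl t))) *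
        ∏ t : RectTorusSite Ls × Fin k, (fun _ : RectTorusSite Ls × Fin k => fun _ : Matrix.specialUnitaryGroup (Fin 2) ℂ => (1 : ℝ)) t (a t) := by
    funext a
    rw [rectPlaquetteHolonomy_of_single_eq_zero a x hi hj, Finset.prod_const_one, mul_one, hf]
    simp only [he1, hℓ, Matrix.cons_val_zero, Matrix.cons_val_one]
  rw [h1, slab_integral_pi_window_one (haarProbability (Matrix.specialUnitaryGroup (Fin 2) ℂ)) e
    (fun _ : RectTorusSite Ls × Fin k => fun _ : Matrix.specialUnitaryGroup (Fin 2) ℂ => (1 : ℝ)) f]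
  simp only [Finset.prod_const_one, mul_one, integral_const, smul_eq_mul, probReal_univ]
  -- the window integral over `Fin 2 → SU(2)` is the double Haar integral
  have hwin : ∫ y : Fin 2 → Matrix.specialUnitaryGroup (Fin 2) ℂ, f y
      ∂(Measure.pi fun _ => haarProbability (Matrix.specialUnitaryGroup (Fin 2) ℂ)) = 1 / 2 := by
    have hmp := measurePreserving_finTwoArrow (haarProbability (Matrix.specialUnitaryGroup (Fin 2) ℂ))
    rw [← hmp.symm.integral_comp' (g := f)]
    have hg : ∀ z : Matrix.specialUnitaryGroup (Fin 2) ℂ × Matrix.specialUnitaryGroup (Fin 2) ℂ,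
        f ((MeasurableEquiv.finTwoArrow).symm z) = ((fundamentalRep (Fin 2) (z.1 * z.2 * z.1⁻¹ * z.2⁻¹)).trace).re := by
      intro z
      simp only [hf, MeasurableEquiv.finTwoArrow_symm_apply, Fin.cons_zero, Fin.cons_one]
    simp_rw [hg]
    have hc : Continuous fun z : Matrix.specialUnitaryGroup (Fin 2) ℂ × Matrix.specialUnitaryGroup (Fin 2) ℂ =>
        ((fundamentalRep (Fin 2) (z.1 * z.2 * z.1⁻¹ * z.2⁻¹)).trace).re :=
      (Complex.continuous_re.comp (Continuous.matrix_trace (continuous_fundamentalRep (Fin 2)))).comp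
        (((continuous_fst.mul continuous_snd).mul continuous_fst.inv).mul continuous_snd.inv)
    rw [integral_prod _ (hc.integrable_of_hasCompactSupport (HasCompactSupport.of_compactSpace _))]
    exact su2_integral_re_trace_commutator
  exact hwin

end Summit.Ventures.YMGap.FlowData
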